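import Summits.Ventures.PackingBounds.Configurations.AlgebraicListConfig
import Summits.Ventures.PackingBounds.Energy.GramPSDMargin
import HarnessLib

/-!
# PSD of a Gram block with entries in a real number field, from integer data (KERNEL-NF, step 2)

Framing: lottery ticket; floor = certified bounds/negative ranges. Venture `PackingBounds`, cell `pub-packcert`,
energy family E3PT (pub-packcert-energy gen 22; design note `KERNEL-NF.md`).

The exact sharp three-point certificates for eight, nine and ten points on `S²` (layouts `generic-NF` /
`generic-NFL`) have Gram blocks `Y` with entries in a real number field `F = ℚ(ξ)`, `ξ` a real root of an integer
polynomial. Here an `F`-valued matrix is given as INTEGER data: entry `(i,j)` is a coefficient list `F_{ij}`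
(low → high, the `leval` encoding of `Configurations/AlgebraicListConfig`) and a common denominator `den`, so the
real entry is `leval ξ F_{ij} / den`. Positive semidefiniteness of the real matrix is reduced to three Boolean
checks on integers, all dischargeable by `decide` on explicit data:
* a RATIONAL WITNESS `Y/S` that is positive definite WITH MARGIN `m/S`: `Y = L Lᵀ + E`, `E` symmetric and
  diagonally dominant with margin `m` (`GramData.checkRows`/`checkRowsF`, `GramData.checkDDm`; conclusion
  `GramData.pd_of_checks_margin`);
* a DEVIATION check (`checkDev`): with `ξ ∈ [a/Dx, b/Dx]`, the scaled interval-Horner enclosures (`ihz`) of the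
  integer polynomials `S·F_{ij} − den·Y_{ij}` give `|leval ξ F_{ij}/den − Y_{ij}/S| ≤ dev_{ij}/(Dx^ℓ·S·den)`, and
  `Σ_j (dev_{ij} + dev_{ji}) ≤ 2·m·den·Dx^ℓ` for every row `i`;
* the generic perturbation lemma `quadForm_nonneg_of_margin`: margin `m'` plus a perturbation whose symmetrised
  absolute row sums are `≤ 2m'` is positive semidefinite.
Conclusion `psd_of_nf_checks`: `0 ≤ Σ_{i,j<r} (leval ξ F_{ij} / den) y_i y_j` for every real `y`.
-/

namespace Summit.Ventures.PackingBounds.Energy.NFGram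

open Finset
open Summit.Ventures.PackingBounds.Config.AlgWeighted
open Summit.Ventures.PackingBounds.Energy.GramData

/-- **Margin + small perturbation ⇒ PSD.** If `m·Σ y_i² ≤ Σ Q_{ij} y_i y_j` for all `y` and the perturbation `P`
has `Σ_j (|P_{ij}| + |P_{ji}|) ≤ 2m` for every `i`, then `Q + P` is positive semidefinite. -/
theorem quadForm_nonneg_of_margin {ι : Type*} [Fintype ι] (Q P : ι → ι → ℝ) (m : ℝ)
    (hQ : ∀ y : ι → ℝ, m * ∑ i, y i ^ 2 ≤ ∑ i, ∑ j, Q i j * y i * y j)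
    (hP : ∀ i, ∑ j, (|P i j| + |P j i|) ≤ 2 * m) (y : ι → ℝ) :
    0 ≤ ∑ i, ∑ j, (Q i j + P i j) * y i * y j := by
  have hsplit : ∑ i, ∑ j, (Q i j + P i j) * y i * y j
      = (∑ i, ∑ j, Q i j * y i * y j) + ∑ i, ∑ j, P i j * y i * y j := by
    rw [← Finset.sum_add_distrib]
    refine Finset.sum_congr rfl fun i _ => ?_
    rw [← Finset.sum_add_distrib]
    refine Finset.sum_congr rfl fun j _ => ?_
    ring
  -- entrywise lower bound of the perturbation
  have hent : ∀ i j, -(|P i j| * (y i ^ 2 + y j ^ 2) / 2) ≤ P i j * y i * y j := by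
    intro i j
    have h1 : |P i j * y i * y j| = |P i j| * (|y i| * |y j|) := by
      rw [abs_mul, abs_mul]; ring
    have h2 : |y i| * |y j| ≤ (y i ^ 2 + y j ^ 2) / 2 := by
      have h3 : 0 ≤ (|y i| - |y j|) ^ 2 := sq_nonneg _
      have h4 : (|y i| - |y j|) ^ 2 = y i ^ 2 + y j ^ 2 - 2 * (|y i| * |y j|) := by
        have ha : |y i| ^ 2 = y i ^ 2 := sq_abs _
        have hb : |y j| ^ 2 = y j ^ 2 := sq_abs _
        nlinarith [ha, hb]
      linarith
    have h5 : |P i j * y i * y j| ≤ |P i j| * ((y i ^ 2 + y j ^ 2) / 2) := by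
      rw [h1]; exact mul_le_mul_of_nonneg_left h2 (abs_nonneg _)
    have h6 := neg_abs_le (P i j * y i * y j)
    have h7 : |P i j| * ((y i ^ 2 + y j ^ 2) / 2) = |P i j| * (y i ^ 2 + y j ^ 2) / 2 := by ring
    linarith
  have hsum : -(m * ∑ i, y i ^ 2) ≤ ∑ i, ∑ j, P i j * y i * y j := by
    have hlow : ∑ i, ∑ j, (-(|P i j| * (y i ^ 2 + y j ^ 2) / 2)) ≤ ∑ i, ∑ j, P i j * y i * y j :=
      Finset.sum_le_sum fun i _ => Finset.sum_le_sum fun j _ => hent i j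
    -- rewrite the lower bound
    have hre : ∑ i, ∑ j, (-(|P i j| * (y i ^ 2 + y j ^ 2) / 2))
        = -(1 / 2) * ∑ i, y i ^ 2 * ∑ j, (|P i j| + |P j i|) := by
      have hA : ∑ i, ∑ j, (-(|P i j| * (y i ^ 2 + y j ^ 2) / 2))
          = -(1 / 2) * ((∑ i, ∑ j, |P i j| * y i ^ 2) + ∑ i, ∑ j, |P i j| * y j ^ 2) := by
        rw [← Finset.sum_add_distrib, Finset.mul_sum]
        refine Finset.sum_congr rfl fun i _ => ?_
        rw [← Finset.sum_add_distrib, Finset.mul_sum]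
        refine Finset.sum_congr rfl fun j _ => ?_
        ring
      have hB : ∑ i, ∑ j, |P i j| * y j ^ 2 = ∑ i, ∑ j, |P j i| * y i ^ 2 := by
        rw [Finset.sum_comm]
      have hC : (∑ i, ∑ j, |P i j| * y i ^ 2) + (∑ i, ∑ j, |P j i| * y i ^ 2)
          = ∑ i, y i ^ 2 * ∑ j, (|P i j| + |P j i|) := by
        rw [← Finset.sum_add_distrib]
        refine Finset.sum_congr rfl fun i _ => ?_
        rw [Finset.mul_sum, ← Finset.sum_add_distrib]
        refine Finset.sum_congr rfl fun j _ => ?_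
        ring
      rw [hA, hB, hC]
    have hD : ∑ i, y i ^ 2 * ∑ j, (|P i j| + |P j i|) ≤ ∑ i, y i ^ 2 * (2 * m) :=
      Finset.sum_le_sum fun i _ => mul_le_mul_of_nonneg_left (hP i) (sq_nonneg _)
    have hE : ∑ i, y i ^ 2 * (2 * m) = 2 * m * ∑ i, y i ^ 2 := by
      rw [Finset.mul_sum]; refine Finset.sum_congr rfl fun i _ => ?_; ring
    rw [hre] at hlow
    nlinarith [hlow, hD, hE]
  rw [hsplit]
  linarith [hQ y, hsum]

/-! ### Integer data: an `F`-valued matrix as coefficient lists, deviation from a rational witness -/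

/-- Entry `(i,j)` of a list-of-rows matrix of coefficient lists (`[]` outside). -/
def entF (F : List (List (List ℤ))) (i j : ℕ) : List ℤ := (F.getD i []).getD j []

/-- The integer polynomial `S·F_{ij} − den·Y_{ij}` (its value at `ξ` is `S·den` times the deviation of the real
entry `leval ξ F_{ij}/den` from the witness entry `Y_{ij}/S`). -/
def devPoly (F : List (List (List ℤ))) (Y : List (List ℤ)) (S den : ℕ) (i j : ℕ) : List ℤ :=
  lsub (lsmul (S : ℤ) (entF F i j)) [(den : ℤ) * ent Y i j]

/-- Absolute bound of the scaled enclosure of `devPoly`: `max(|lo|, |hi|)` of `ihz a b Dx`. -/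
def devBound (a b : ℤ) (Dx : ℕ) (F : List (List (List ℤ))) (Y : List (List ℤ)) (S den : ℕ) (i j : ℕ) : ℤ :=
  max |(ihz a b Dx (devPoly F Y S den i j)).1| |(ihz a b Dx (devPoly F Y S den i j)).2|

/-- `Σ_{j<n} (devBound i j + devBound j i)`, by structural recursion on `n`. -/
def devRow (a b : ℤ) (Dx : ℕ) (F : List (List (List ℤ))) (Y : List (List ℤ)) (S den : ℕ) (i : ℕ) : ℕ → ℤ
  | 0 => 0
  | n + 1 => devRow a b Dx F Y S den i n + (devBound a b Dx F Y S den i n + devBound a b Dx F Y S den n i)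

/-- Deviation check: every `devPoly F Y S den i j` (`i, j < r`) has length `ℓ`, and for every row `i < r`,
`Σ_{j<r} (dev_{ij} + dev_{ji}) ≤ 2·m·den·Dx^ℓ`. -/
def checkDev (r ℓ : ℕ) (a b : ℤ) (Dx : ℕ) (F : List (List (List ℤ))) (Y : List (List ℤ)) (S den m : ℕ) : Bool :=
  (List.range r).all fun i =>
    ((List.range r).all fun j => (devPoly F Y S den i j).length == ℓ) &&
      decide (devRow a b Dx F Y S den i r ≤ 2 * (m : ℤ) * (den : ℤ) * (Dx : ℤ) ^ ℓ)

/-- Value of `devPoly` at `ξ`. -/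
theorem leval_devPoly (ξ : ℝ) (F : List (List (List ℤ))) (Y : List (List ℤ)) (S den : ℕ) (i j : ℕ) :
    leval ξ (devPoly F Y S den i j) = (S : ℝ) * leval ξ (entF F i j) - (den : ℝ) * (ent Y i j : ℝ) := by
  simp only [devPoly, leval_lsub, leval_lsmul, leval_cons, leval_nil, mul_zero, add_zero]
  push_cast
  ring

/-- `devRow` is the finite sum it computes (cast to `ℝ`). -/
theorem devRow_eq (a b : ℤ) (Dx : ℕ) (F : List (List (List ℤ))) (Y : List (List ℤ)) (S den : ℕ) (i : ℕ) :
    ∀ n, (devRow a b Dx F Y S den i n : ℝ)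
      = ∑ j ∈ Finset.range n, ((devBound a b Dx F Y S den i j : ℝ) + (devBound a b Dx F Y S den j i : ℝ))
  | 0 => by simp [devRow]
  | n + 1 => by
    rw [devRow, Finset.sum_range_succ, Int.cast_add, Int.cast_add, devRow_eq a b Dx F Y S den i n]

/-- Unpack a checked deviation fact. -/
theorem of_checkDev {r ℓ : ℕ} {a b : ℤ} {Dx : ℕ} {F : List (List (List ℤ))} {Y : List (List ℤ)} {S den m : ℕ}
    (h : checkDev r ℓ a b Dx F Y S den m = true) :
    (∀ i j, i < r → j < r → (devPoly F Y S den i j).length = ℓ) ∧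
      ∀ i, i < r → devRow a b Dx F Y S den i r ≤ 2 * (m : ℤ) * (den : ℤ) * (Dx : ℤ) ^ ℓ := by
  simp only [checkDev, List.all_eq_true, List.mem_range, Bool.and_eq_true, beq_iff_eq,
    decide_eq_true_eq] at h
  exact ⟨fun i j hi hj => (h i hi).1 j hj, fun i hi => (h i hi).2⟩

/-- From the enclosure: `Dx^ℓ · |leval ξ (devPoly i j)| ≤ devBound i j` when the polynomial has length `ℓ`. -/
theorem abs_devPoly_le {a b : ℤ} {Dx : ℕ} {ξ : ℝ} (ha : (a : ℝ) ≤ Dx * ξ) (hb : (Dx : ℝ) * ξ ≤ b)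
    (F : List (List (List ℤ))) (Y : List (List ℤ)) (S den : ℕ) (i j : ℕ) {ℓ : ℕ}
    (hl : (devPoly F Y S den i j).length = ℓ) :
    (Dx : ℝ) ^ ℓ * |leval ξ (devPoly F Y S den i j)| ≤ (devBound a b Dx F Y S den i j : ℝ) := by
  have hs := ihz_sound a b Dx ξ ha hb (devPoly F Y S den i j)
  rw [hl] at hs
  obtain ⟨hlo, hhi⟩ := hs
  have hpow : (0 : ℝ) ≤ (Dx : ℝ) ^ ℓ := by positivity
  rw [← abs_of_nonneg hpow, ← abs_mul]
  simp only [devBound, Int.cast_max, Int.cast_abs]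
  rcases le_total 0 ((Dx : ℝ) ^ ℓ * leval ξ (devPoly F Y S den i j)) with h0 | h0
  · rw [abs_of_nonneg h0]
    exact le_trans (le_trans hhi (le_abs_self _)) (le_max_right _ _)
  · rw [abs_of_nonpos h0]
    have : -((Dx : ℝ) ^ ℓ * leval ξ (devPoly F Y S den i j)) ≤ |((ihz a b Dx (devPoly F Y S den i j)).1 : ℝ)| := by
      have := neg_abs_le (((ihz a b Dx (devPoly F Y S den i j)).1 : ℝ))
      linarith
    exact le_trans this (le_max_left _ _)

/-- **PSD of a number-field Gram block from checked integer data.** `ξ ∈ [a/Dx, b/Dx]`; the rational witness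
`Y/S` satisfies `Y = L Lᵀ + E` with `E` symmetric and diagonally dominant with margin `m` (rows `< r`); the
deviation check `checkDev r ℓ a b Dx F Y S den m` holds. Then the real symmetric form with entries
`leval ξ F_{ij} / den` is positive semidefinite on `Fin r`. -/
theorem psd_of_nf_checks (r s m ℓ : ℕ) (F : List (List (List ℤ))) (Y L E : List (List ℤ))
    (S den Dx : ℕ) (a b : ℤ) (ξ : ℝ) (hS : 0 < S) (hden : 0 < den) (hDx : 0 < Dx)
    (ha : (a : ℝ) ≤ Dx * ξ) (hb : (Dx : ℝ) * ξ ≤ b)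
    (hrows : ∀ i j, i < r → j < r → ent Y i j = dotRows L i j s + ent E i j ∧ ent E i j = ent E j i)
    (hdd : ∀ i, i < r → absRow E i r + 2 * (m : ℤ) ≤ 2 * ent E i i)
    (hdev : checkDev r ℓ a b Dx F Y S den m = true) (y : Fin r → ℝ) :
    0 ≤ ∑ i : Fin r, ∑ j : Fin r, (leval ξ (entF F i j) / den) * y i * y j := by
  have hSr : (0 : ℝ) < S := by exact_mod_cast hS
  have hdenr : (0 : ℝ) < den := by exact_mod_cast hden
  have hDxr : (0 : ℝ) < Dx := by exact_mod_cast hDx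
  have hpow : (0 : ℝ) < (Dx : ℝ) ^ ℓ := by positivity
  obtain ⟨hlen, hrow⟩ := of_checkDev hdev
  -- the rational witness with margin m/S
  set Q : Fin r → Fin r → ℝ := fun i j => (ent Y i j : ℝ) / S with hQdef
  set P : Fin r → Fin r → ℝ := fun i j => leval ξ (entF F i j) / den - (ent Y i j : ℝ) / S with hPdef
  have hQ : ∀ z : Fin r → ℝ, (m : ℝ) / S * ∑ i, z i ^ 2 ≤ ∑ i, ∑ j, Q i j * z i * z j := by
    intro z
    have h := pd_of_checks_margin r s m Y L E hrows hdd z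
    have hre : ∑ i, ∑ j, Q i j * z i * z j = (∑ i : Fin r, ∑ j : Fin r, (ent Y i j : ℝ) * z i * z j) / S := by
      rw [Finset.sum_div]
      refine Finset.sum_congr rfl fun i _ => ?_
      rw [Finset.sum_div]
      refine Finset.sum_congr rfl fun j _ => ?_
      simp only [hQdef]; ring
    rw [hre, div_mul_eq_mul_div, le_div_iff₀ hSr, div_mul_cancel₀ _ hSr.ne']
    exact h
  -- the perturbation bound
  have hPent : ∀ i j : Fin r, |P i j| ≤ (devBound a b Dx F Y S den i j : ℝ) / ((Dx : ℝ) ^ ℓ * S * den) := by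
    intro i j
    have hl := hlen i j i.2 j.2
    have hb' := abs_devPoly_le ha hb F Y S den i j hl
    have hval := leval_devPoly ξ F Y S den i j
    have hP' : P i j = leval ξ (devPoly F Y S den i j) / ((S : ℝ) * den) := by
      simp only [hPdef]; rw [hval]; field_simp
    rw [hP', abs_div, abs_of_pos (mul_pos hSr hdenr), div_le_div_iff₀ (mul_pos hSr hdenr) (by positivity)]
    have : |leval ξ (devPoly F Y S den i j)| * ((Dx : ℝ) ^ ℓ * S * den)
        = ((Dx : ℝ) ^ ℓ * |leval ξ (devPoly F Y S den i j)|) * (S * den) := by ring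
    rw [this]
    exact mul_le_mul_of_nonneg_right hb' (by positivity)
  have hP : ∀ i : Fin r, ∑ j, (|P i j| + |P j i|) ≤ 2 * ((m : ℝ) / S) := by
    intro i
    have h1 : ∑ j : Fin r, (|P i j| + |P j i|)
        ≤ ∑ j : Fin r, (((devBound a b Dx F Y S den i j : ℝ) + (devBound a b Dx F Y S den j i : ℝ))
            / ((Dx : ℝ) ^ ℓ * S * den)) := by
      refine Finset.sum_le_sum fun j _ => ?_
      rw [add_div]
      exact add_le_add (hPent i j) (hPent j i)
    have h2 : ∑ j : Fin r, (((devBound a b Dx F Y S den i j : ℝ) + (devBound a b Dx F Y S den j i : ℝ))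
            / ((Dx : ℝ) ^ ℓ * S * den))
        = (devRow a b Dx F Y S den i r : ℝ) / ((Dx : ℝ) ^ ℓ * S * den) := by
      rw [devRow_eq, ← Finset.sum_div,
        ← Fin.sum_univ_eq_sum_range (fun j => ((devBound a b Dx F Y S den i j : ℝ) + (devBound a b Dx F Y S den j i : ℝ))) r]
    have h3 : (devRow a b Dx F Y S den i r : ℝ) ≤ 2 * (m : ℝ) * den * (Dx : ℝ) ^ ℓ := by
      exact_mod_cast hrow i i.2
    rw [h2] at h1
    refine le_trans h1 ?_
    rw [div_le_iff₀ (by positivity)]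
    have : 2 * ((m : ℝ) / S) * ((Dx : ℝ) ^ ℓ * S * den) = 2 * (m : ℝ) * den * (Dx : ℝ) ^ ℓ := by
      field_simp
    rw [this]
    exact h3
  have key := quadForm_nonneg_of_margin Q P ((m : ℝ) / S) hQ hP y
  have hre : ∑ i : Fin r, ∑ j : Fin r, (leval ξ (entF F i j) / den) * y i * y j
      = ∑ i, ∑ j, (Q i j + P i j) * y i * y j := by
    refine Finset.sum_congr rfl fun i _ => Finset.sum_congr rfl fun j _ => ?_
    simp only [hQdef, hPdef]; ring
  rw [hre]
  exact key

end Summit.Ventures.PackingBounds.Energy.NFGram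

/-! ### Variant with PER-ENTRY denominators (keeps the integer data small when only a few entries have large height)

Entry `(i,j)` of the real matrix is `leval ξ F_{ij} / Dn_{ij}` with a positive integer denominator per entry; the
emitter also supplies integer deviation bounds `C_{ij}` and the checker verifies `dev_{ij} ≤ C_{ij}·Dn_{ij}` (so that
`|entry − Y_{ij}/S| ≤ C_{ij}/(Dx^ℓ·S)`) and `Σ_j (C_{ij} + C_{ji}) ≤ 2·m·Dx^ℓ` — no integer division in the kernel. -/

namespace Summit.Ventures.PackingBounds.Energy.NFGram

open Finset
open Summit.Ventures.PackingBounds.Config.AlgWeighted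
open Summit.Ventures.PackingBounds.Energy.GramData

/-- Entry `(i,j)` of a list-of-rows matrix of natural numbers (`0` outside). -/
def entN (M : List (List ℕ)) (i j : ℕ) : ℕ := (M.getD i []).getD j 0

/-- `S·F_{ij} − Dn_{ij}·Y_{ij}` (its value at `ξ` is `S·Dn_{ij}` times the deviation of entry `(i,j)`). -/
def devPoly2 (F : List (List (List ℤ))) (Dn : List (List ℕ)) (Y : List (List ℤ)) (S : ℕ) (i j : ℕ) : List ℤ :=
  lsub (lsmul (S : ℤ) (entF F i j)) [(entN Dn i j : ℤ) * ent Y i j]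

/-- Absolute bound of the scaled enclosure of `devPoly2`. -/
def devBound2 (a b : ℤ) (Dx : ℕ) (F : List (List (List ℤ))) (Dn : List (List ℕ)) (Y : List (List ℤ)) (S : ℕ)
    (i j : ℕ) : ℤ :=
  max |(ihz a b Dx (devPoly2 F Dn Y S i j)).1| |(ihz a b Dx (devPoly2 F Dn Y S i j)).2|

/-- `Σ_{j<n} (C_{ij} + C_{ji})`, by structural recursion on `n`. -/
def crow (C : List (List ℤ)) (i : ℕ) : ℕ → ℤ
  | 0 => 0
  | n + 1 => crow C i n + (ent C i n + ent C n i)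

/-- Per-entry deviation check: lengths `= ℓ`, denominators positive, `dev_{ij} ≤ C_{ij}·Dn_{ij}`, and
`Σ_{j<r} (C_{ij} + C_{ji}) ≤ 2·m·Dx^ℓ` for every row `i < r`. -/
def checkDev2 (r ℓ : ℕ) (a b : ℤ) (Dx : ℕ) (F : List (List (List ℤ))) (Dn : List (List ℕ)) (C : List (List ℤ))
    (Y : List (List ℤ)) (S m : ℕ) : Bool :=
  (List.range r).all fun i =>
    ((List.range r).all fun j =>
        ((devPoly2 F Dn Y S i j).length == ℓ) && decide (0 < entN Dn i j) &&
          decide (devBound2 a b Dx F Dn Y S i j ≤ ent C i j * (entN Dn i j : ℤ))) &&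
      decide (crow C i r ≤ 2 * (m : ℤ) * (Dx : ℤ) ^ ℓ)

/-- Value of `devPoly2` at `ξ`. -/
theorem leval_devPoly2 (ξ : ℝ) (F : List (List (List ℤ))) (Dn : List (List ℕ)) (Y : List (List ℤ)) (S : ℕ)
    (i j : ℕ) :
    leval ξ (devPoly2 F Dn Y S i j) = (S : ℝ) * leval ξ (entF F i j) - (entN Dn i j : ℝ) * (ent Y i j : ℝ) := by
  simp only [devPoly2, leval_lsub, leval_lsmul, leval_cons, leval_nil, mul_zero, add_zero]
  push_cast
  ring

/-- `crow` is the finite sum it computes (cast to `ℝ`). -/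
theorem crow_eq (C : List (List ℤ)) (i : ℕ) :
    ∀ n, (crow C i n : ℝ) = ∑ j ∈ Finset.range n, ((ent C i j : ℝ) + (ent C j i : ℝ))
  | 0 => by simp [crow]
  | n + 1 => by rw [crow, Finset.sum_range_succ, Int.cast_add, Int.cast_add, crow_eq C i n]

/-- Unpack a checked per-entry deviation fact. -/
theorem of_checkDev2 {r ℓ : ℕ} {a b : ℤ} {Dx : ℕ} {F : List (List (List ℤ))} {Dn : List (List ℕ)}
    {C Y : List (List ℤ)} {S m : ℕ} (h : checkDev2 r ℓ a b Dx F Dn C Y S m = true) :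
    (∀ i j, i < r → j < r →
        (devPoly2 F Dn Y S i j).length = ℓ ∧ 0 < entN Dn i j ∧
          devBound2 a b Dx F Dn Y S i j ≤ ent C i j * (entN Dn i j : ℤ)) ∧
      ∀ i, i < r → crow C i r ≤ 2 * (m : ℤ) * (Dx : ℤ) ^ ℓ := by
  simp only [checkDev2, List.all_eq_true, List.mem_range, Bool.and_eq_true, beq_iff_eq,
    decide_eq_true_eq] at h
  exact ⟨fun i j hi hj => ⟨((h i hi).1 j hj).1.1, ((h i hi).1 j hj).1.2, ((h i hi).1 j hj).2⟩,
    fun i hi => (h i hi).2⟩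

/-- From the enclosure: `Dx^ℓ · |leval ξ (devPoly2 i j)| ≤ devBound2 i j` when the polynomial has length `ℓ`. -/
theorem abs_devPoly2_le {a b : ℤ} {Dx : ℕ} {ξ : ℝ} (ha : (a : ℝ) ≤ Dx * ξ) (hb : (Dx : ℝ) * ξ ≤ b)
    (F : List (List (List ℤ))) (Dn : List (List ℕ)) (Y : List (List ℤ)) (S : ℕ) (i j : ℕ) {ℓ : ℕ}
    (hl : (devPoly2 F Dn Y S i j).length = ℓ) :
    (Dx : ℝ) ^ ℓ * |leval ξ (devPoly2 F Dn Y S i j)| ≤ (devBound2 a b Dx F Dn Y S i j : ℝ) := by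
  have hs := ihz_sound a b Dx ξ ha hb (devPoly2 F Dn Y S i j)
  rw [hl] at hs
  obtain ⟨hlo, hhi⟩ := hs
  have hpow : (0 : ℝ) ≤ (Dx : ℝ) ^ ℓ := by positivity
  rw [← abs_of_nonneg hpow, ← abs_mul]
  simp only [devBound2, Int.cast_max, Int.cast_abs]
  rcases le_total 0 ((Dx : ℝ) ^ ℓ * leval ξ (devPoly2 F Dn Y S i j)) with h0 | h0
  · rw [abs_of_nonneg h0]
    exact le_trans (le_trans hhi (le_abs_self _)) (le_max_right _ _)
  · rw [abs_of_nonpos h0]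
    have : -((Dx : ℝ) ^ ℓ * leval ξ (devPoly2 F Dn Y S i j))
        ≤ |((ihz a b Dx (devPoly2 F Dn Y S i j)).1 : ℝ)| := by
      have := neg_abs_le (((ihz a b Dx (devPoly2 F Dn Y S i j)).1 : ℝ))
      linarith
    exact le_trans this (le_max_left _ _)

/-- **PSD of a number-field Gram block from checked integer data, per-entry denominators.** As
`psd_of_nf_checks`, with entry `(i,j)` of the real matrix equal to `leval ξ F_{ij} / Dn_{ij}`. -/
theorem psd_of_nf_checks2 (r s m ℓ : ℕ) (F : List (List (List ℤ))) (Dn : List (List ℕ)) (C : List (List ℤ))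
    (Y L E : List (List ℤ)) (S Dx : ℕ) (a b : ℤ) (ξ : ℝ) (hS : 0 < S) (hDx : 0 < Dx)
    (ha : (a : ℝ) ≤ Dx * ξ) (hb : (Dx : ℝ) * ξ ≤ b)
    (hrows : ∀ i j, i < r → j < r → ent Y i j = dotRows L i j s + ent E i j ∧ ent E i j = ent E j i)
    (hdd : ∀ i, i < r → absRow E i r + 2 * (m : ℤ) ≤ 2 * ent E i i)
    (hdev : checkDev2 r ℓ a b Dx F Dn C Y S m = true) (y : Fin r → ℝ) :
    0 ≤ ∑ i : Fin r, ∑ j : Fin r, (leval ξ (entF F i j) / (entN Dn i j : ℝ)) * y i * y j := by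
  have hSr : (0 : ℝ) < S := by exact_mod_cast hS
  have hDxr : (0 : ℝ) < Dx := by exact_mod_cast hDx
  have hpow : (0 : ℝ) < (Dx : ℝ) ^ ℓ := by positivity
  obtain ⟨hent, hrow⟩ := of_checkDev2 hdev
  set Q : Fin r → Fin r → ℝ := fun i j => (ent Y i j : ℝ) / S with hQdef
  set P : Fin r → Fin r → ℝ := fun i j => leval ξ (entF F i j) / (entN Dn i j : ℝ) - (ent Y i j : ℝ) / S
    with hPdef
  have hQ : ∀ z : Fin r → ℝ, (m : ℝ) / S * ∑ i, z i ^ 2 ≤ ∑ i, ∑ j, Q i j * z i * z j := by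
    intro z
    have h := pd_of_checks_margin r s m Y L E hrows hdd z
    have hre : ∑ i, ∑ j, Q i j * z i * z j = (∑ i : Fin r, ∑ j : Fin r, (ent Y i j : ℝ) * z i * z j) / S := by
      rw [Finset.sum_div]
      refine Finset.sum_congr rfl fun i _ => ?_
      rw [Finset.sum_div]
      refine Finset.sum_congr rfl fun j _ => ?_
      simp only [hQdef]; ring
    rw [hre, div_mul_eq_mul_div, le_div_iff₀ hSr, div_mul_cancel₀ _ hSr.ne']
    exact h
  have hPent : ∀ i j : Fin r, |P i j| ≤ (ent C i j : ℝ) / ((Dx : ℝ) ^ ℓ * S) := by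
    intro i j
    obtain ⟨hl, hdpos, hC⟩ := hent i j i.2 j.2
    have hdr : (0 : ℝ) < (entN Dn i j : ℝ) := by exact_mod_cast hdpos
    have hb' := abs_devPoly2_le ha hb F Dn Y S i j hl
    have hval := leval_devPoly2 ξ F Dn Y S i j
    have hCr : (devBound2 a b Dx F Dn Y S i j : ℝ) ≤ (ent C i j : ℝ) * (entN Dn i j : ℝ) := by
      exact_mod_cast hC
    have hP' : P i j = leval ξ (devPoly2 F Dn Y S i j) / ((S : ℝ) * (entN Dn i j : ℝ)) := by
      simp only [hPdef]; rw [hval]; field_simp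
    rw [hP', abs_div, abs_of_pos (mul_pos hSr hdr), div_le_div_iff₀ (mul_pos hSr hdr) (by positivity)]
    have h1 : |leval ξ (devPoly2 F Dn Y S i j)| * ((Dx : ℝ) ^ ℓ * S)
        = ((Dx : ℝ) ^ ℓ * |leval ξ (devPoly2 F Dn Y S i j)|) * S := by ring
    rw [h1]
    have h2 : (ent C i j : ℝ) * ((S : ℝ) * (entN Dn i j : ℝ)) = ((ent C i j : ℝ) * (entN Dn i j : ℝ)) * S := by ring
    rw [h2]
    exact mul_le_mul_of_nonneg_right (le_trans hb' hCr) hSr.le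
  have hP : ∀ i : Fin r, ∑ j, (|P i j| + |P j i|) ≤ 2 * ((m : ℝ) / S) := by
    intro i
    have h1 : ∑ j : Fin r, (|P i j| + |P j i|)
        ≤ ∑ j : Fin r, (((ent C i j : ℝ) + (ent C j i : ℝ)) / ((Dx : ℝ) ^ ℓ * S)) := by
      refine Finset.sum_le_sum fun j _ => ?_
      rw [add_div]
      exact add_le_add (hPent i j) (hPent j i)
    have h2 : ∑ j : Fin r, (((ent C i j : ℝ) + (ent C j i : ℝ)) / ((Dx : ℝ) ^ ℓ * S))
        = (crow C i r : ℝ) / ((Dx : ℝ) ^ ℓ * S) := by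
      rw [crow_eq, ← Finset.sum_div,
        ← Fin.sum_univ_eq_sum_range (fun j => ((ent C i j : ℝ) + (ent C j i : ℝ))) r]
    have h3 : (crow C i r : ℝ) ≤ 2 * (m : ℝ) * (Dx : ℝ) ^ ℓ := by exact_mod_cast hrow i i.2
    rw [h2] at h1
    refine le_trans h1 ?_
    rw [div_le_iff₀ (by positivity)]
    have : 2 * ((m : ℝ) / S) * ((Dx : ℝ) ^ ℓ * S) = 2 * (m : ℝ) * (Dx : ℝ) ^ ℓ := by field_simp
    rw [this]
    exact h3
  have key := quadForm_nonneg_of_margin Q P ((m : ℝ) / S) hQ hP y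
  have hre : ∑ i : Fin r, ∑ j : Fin r, (leval ξ (entF F i j) / (entN Dn i j : ℝ)) * y i * y j
      = ∑ i, ∑ j, (Q i j + P i j) * y i * y j := by
    refine Finset.sum_congr rfl fun i _ => Finset.sum_congr rfl fun j _ => ?_
    simp only [hQdef, hPdef]; ring
  rw [hre]
  exact key

end Summit.Ventures.PackingBounds.Energy.NFGram
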